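import Literature.Barriers.AnomalousDissipation.ObukhovCorrsinThresholdProofs
import HarnessLib

/-!
# The Obukhov–Corrsin threshold is scale-local: one good band of scales, and the inverse
structure-function bound for witnesses

Barrier-audit addendum (2026-08-17, gen 17, D-0021) to the named fact
`Literature.Barriers.AnomalousDissipation.DrivasElgindiIyerJeong2022_thm4`
(`Barriers/AnomalousDissipation/ObukhovCorrsinThreshold`; new scope caveat (xiii)). Audit of the
discharge `ObukhovCorrsinThresholdProofs` at the level of its lemmas: the printed proof of
Drivas–Elgindi–Iyer–Jeong 2022, Thm. 4 ((5.8)–(5.10), arXiv text p. 17, l. 60–70 and p. 18,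
l. 1–11) and its Lean discharge use the hypothesis "`θ^κ` bounded in `L^∞(0,T; C^β)`" ONLY through
the sup-oscillation of the scalar AT THE ONE MOLLIFICATION SCALE `ℓ`,
`ω(ℓ) := ess sup_t sup_x sup_{‖y‖ ≤ ℓ} |θ(t, x - y) - θ(t, x)|` (and `ω₀(ℓ)` for the datum):
every kernel average in the Constantin–E–Titi estimates (`Torus.abs_integral_kernel_mul_le`,
`Torus.abs_integral_partialDeriv_kernel_mul_le`) integrates increments `θ(x - y) - θ(x)` against
`k_ℓ(y)`, `∇k_ℓ(y)`, supported in `{‖y‖ ≤ ℓ}`. Reading (5.9)–(5.10) with `ω(ℓ)` in place of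
`[θ]_β ℓ^β` gives, for `u ∈ L¹(0,T; C^{0,α})` with `‖u‖_{L¹C^{0,α}} ≤ K` and `0 < ℓ ≤ 1/4`,

  `2κ ∫₀ᵀ ‖∇θ‖²_{L²} ≤ ω₀(ℓ)² + 2 (2 d C₁ K ω(ℓ)² ℓ^{α-1} + T κ d C₁² ω(ℓ)² ℓ^{-2})`     (†)

(`two_mul_eScalarDissipation_le_scaleLocal`; `C₁ = Torus.gradProfileMass d`), of which the
fixed-scale bound `DrivasElgindiIyerJeong2022_thm4.two_mul_eScalarDissipation_le` of the discharge
is the case `ω(ℓ) ≤ Mℓ^β`. Consequences, all kernel-checked below: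

* ONE GOOD SCALE KILLS THE ANOMALY (`….noAnomaly_of_one_good_scale`): along any family
  (`j`-dependent fields with `‖u_j‖_{L¹C^{0,α}} ≤ K`, data, `κ_j > 0` — not even `κ_j → 0` is
  needed) for which there are scales `ℓ_j ∈ (0, 1/4]` with `ω₀,ⱼ(ℓ_j) → 0`,
  `ω_j(ℓ_j)² ℓ_j^{α-1} → 0` and `κ_j ω_j(ℓ_j)² ℓ_j^{-2} → 0`, the scalar dissipation tends to `0`.
  With `ω_j(ℓ_j) ≤ M ℓ_j^β`, `β > (1-α)/2`, this asks only `ℓ_j → 0` and `κ_j ℓ_j^{2β-2} → 0`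
  (`….noAnomaly_of_holder_at_one_scale`): the Hölder hypothesis of the block is needed at NO scale
  above `ℓ_j` and — since `κ^{1/(2-2β)} ≪ κ^{1/(1+α)}` above the line — may be placed anywhere in
  `[κ_j^{1/(2-2β)-}, o(1)]`, in particular strictly below the Obukhov–Corrsin cut-off
  `κ_j^{1/(1+α)}` of the print's optimisation.
* THE INVERSE STRUCTURE-FUNCTION BOUND (`….osc_sq_lower_bound`): if `2κ∫₀ᵀ‖∇θ‖² ≥ e` then at
  EVERY scale `ℓ ∈ [κ^{1/(1+α)}, 1/4]`
  `ω(ℓ)² ≥ (e - ω₀(ℓ)²) ℓ^{1-α} / (2 d C₁ (2K + C₁T))`,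
  i.e. a witness family with a dissipation floor `e > 0` (fixed continuous datum, or any data with
  `ω₀,ⱼ(ℓ) → 0` uniformly, or the long-time readings where the datum term is free) must SATURATE
  the Obukhov–Corrsin scaling `S_∞^{θ_j}(ℓ) := ω_j(ℓ) ≳ ℓ^{(1-α)/2}` at every scale of the whole
  inertial–convective range `κ_j^{1/(1+α)} ≤ ℓ ≲ 1` simultaneously, uniformly in `j` — the
  rigorous `p = ∞` form of "`S_p^θ(ℓ) ∼ ℓ^{p(1-α)/2}`, `ℓ_κ ≪ ℓ ≪ L^θ`" [cite: DrivasEtAl2022, §5]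
  as a NECESSARY condition, not merely the loss of every uniform Hölder exponent `β > (1-α)/2`
  (which constrains only the worst scale) nor only saturation near the cut-off (caveat (xii)).
* BANDS (on paper, elementary): for `ℓ ≤ 1/8` and `d` non-empty,
  `ω(ℓ) ≤ 3 sup_{t,x} sup_{ℓ ≤ ‖y‖ ≤ 2ℓ} |θ(t,x-y) - θ(t,x)|` (write `y = (y + y′) - y′` with
  `‖y′‖ = ℓ` parallel to a shortest representative of `y`, so that `‖y + y′‖ = ‖y‖ + ℓ ∈ [ℓ, 2ℓ]`),
  so every statement above holds with the oscillation over `{‖y‖ ≤ ℓ}` replaced by the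
  oscillation over the single dyadic band `{ℓ ≤ ‖y‖ ≤ 2ℓ}`: a `β`-Hölder bound, `β > (1-α)/2`, on
  ONE dyadic band of scales `ℓ_j → 0` with `κ_jℓ_j^{2β-2} → 0` already excludes the anomaly, and a
  witness is Obukhov–Corrsin-rough in EVERY dyadic band between `κ_j^{1/(1+α)}` and the
  macroscale. The velocity hypothesis is scale-local in the same way (only `‖δ_y u(t)‖_∞`,
  `‖y‖ ≤ ℓ`, enters `τ_ℓ`), which is not recorded as a theorem here.

## Contents

* `ScaleLocalCorner.*` — the sup-form CET estimates (6), (7), (9)–(10) and the cumulant bound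
  of `TorusMollifierHolder` with the Hölder hypothesis on the scalar replaced by an oscillation
  bound at scale `ε`, and the slice bound `neg_integral_conv_mul_flux_le_of_osc` (shape of
  `Torus.neg_integral_conv_mul_flux_le_of_holderWith` with `C_θ ε^β ↦ w`);
* `two_mul_eScalarDissipation_le_scaleLocal` — (†);
* `DrivasElgindiIyerJeong2022_thm4_scaleLocal.noAnomaly_of_one_good_scale`,
  `DrivasElgindiIyerJeong2022_thm4_scaleLocal.noAnomaly_of_holder_at_one_scale` — families;
* `DrivasElgindiIyerJeong2022_thm4_scaleLocal.osc_sq_lower_bound` — the witness constraint.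

## Mathlib / tree search

Tree: `TorusMollifierHolder` (`Torus.abs_integral_kernel_mul_le`,
`Torus.abs_integral_partialDeriv_kernel_mul_le` — already stated for functions bounded on
`{‖y‖ ≤ ε}`; `Torus.abs_sub_le_of_holderWith_of_norm_le`), `TorusMollifierEstimates`
(`Torus.convolution_kernel_sub_self_apply`, `Torus.partialDeriv_convolution_kernel_apply`),
`TorusCommutatorEstimate` (`Torus.convolution_mul_sub_mul_convolution`), `PassiveScalarHolderSlice`
(`Torus.integral_mul_inner_gradient_conv_conv_eq_sum`, `Torus.integrable_apply_mul_of_norm_le`),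
`PassiveScalarEnergySlice` (`Torus.integral_conv_mul_flux_eq`), `ObukhovCorrsinThresholdProofs`
(`setLIntegral_Ioo_le_of_ae_le`, the model proof `two_mul_eScalarDissipation_le`). Mathlib:
`Filter.Tendsto.rpow_const_nhds_zero`, `ENNReal.tendsto_ofReal`, `ENNReal.ofReal_le_ofReal_iff`.

## References

* T. D. Drivas, T. M. Elgindi, G. Iyer, I.-J. Jeong, *Anomalous dissipation in passive scalar
  transport*, Arch. Ration. Mech. Anal. 243 (2022) 1151–1180 (arXiv:1911.03271), §5 (p. 17,
  l. 3–17: the inertial–convective range `ℓ_κ ≪ ℓ ≪ L^θ` and `S_p^θ(ℓ) ∼ ℓ^{p(1-α)/2}`), Thm. 4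
  (p. 17, l. 33–41) and its proof, (5.8)–(5.10) (p. 17, l. 60–70; p. 18, l. 1–11). Bib key
  `DrivasEtAl2022`.
* P. Constantin, W. E, E. S. Titi, Comm. Math. Phys. 165 (1994), 207–209, (6)–(11). Bib key
  `ConstantinETiti1994`.
-/

open MeasureTheory Set Filter Topology Function
open scoped ENNReal NNReal Convolution InnerProductSpace

noncomputable section

namespace Literature.Barriers.AnomalousDissipation

open Literature.Analysis Literature.Analysis.FunctionSpaces Literature.Analysis.FluidPDE

namespace ScaleLocalCorner

/-! ## Sup-form mollifier estimates against the oscillation at one scale -/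

section FunctionSpaces

variable {d : Type*} [Fintype d] {ε : ℝ}

/-- An oscillation bound at scale `ε ≥ 0` is non-negative (take `y = 0`). [folklore] -/
theorem osc_nonneg {f : UnitAddTorus d → ℝ} {w : ℝ} (hε : 0 ≤ ε)
    (hf : ∀ x y : UnitAddTorus d, ‖y‖ ≤ ε → |f (x - y) - f x| ≤ w) : 0 ≤ w := by
  have h := hf 0 0 (by simpa using hε)
  simpa using h

/-- **CET (6), sup form, scale-local**: if `|f(x - y) - f(x)| ≤ w` for `‖y‖ ≤ ε` then
`|(f ⋆ k_ε)(x) - f(x)| ≤ w` (the case `w = C ε^r` is `Torus.abs_convolution_kernel_sub_self_le`).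
[cite: ConstantinETiti1994, (6)] -/
theorem abs_convolution_kernel_sub_self_le_of_osc {f : UnitAddTorus d → ℝ}
    (hfi : Integrable f volume) {w : ℝ}
    (hf : ∀ x y : UnitAddTorus d, ‖y‖ ≤ ε → |f (x - y) - f x| ≤ w) (hε : 0 < ε) (hε' : ε ≤ 1 / 4)
    (x : UnitAddTorus d) : |(f ⋆ Torus.kernel ε) x - f x| ≤ w := by
  rw [Torus.convolution_kernel_sub_self_apply hfi hε hε' x]
  simp only [smul_eq_mul]
  exact Torus.abs_integral_kernel_mul_le hε hε' fun y hy => hf x y hy.le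

/-- **CET (7), sup form, scale-local** ("standard estimates for mollified gradients"): if
`|f(x - y) - f(x)| ≤ w` for `‖y‖ ≤ ε` then `|∂ⱼ(f ⋆ k_ε)(x)| ≤ (C₁/ε) w` (the case `w = C ε^r`
is `Torus.abs_partialDeriv_convolution_kernel_le`). [cite: ConstantinETiti1994, (7)] -/
theorem abs_partialDeriv_convolution_kernel_le_of_osc [DecidableEq d] {f : UnitAddTorus d → ℝ}
    (hfi : Integrable f volume) {w : ℝ}
    (hf : ∀ x y : UnitAddTorus d, ‖y‖ ≤ ε → |f (x - y) - f x| ≤ w) (hε : 0 < ε) (hε' : ε ≤ 1 / 4)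
    (j : d) (x : UnitAddTorus d) :
    |Torus.partialDeriv j (f ⋆ Torus.kernel ε) x| ≤ ε⁻¹ * Torus.gradProfileMass d * w := by
  rw [Torus.partialDeriv_convolution_kernel_apply hfi hε hε' j x]
  simp only [smul_eq_mul]
  exact Torus.abs_integral_partialDeriv_kernel_mul_le hε hε' j fun y hy => hf x y hy

/-- **CET (9), sup form, scale-local in the second factor**: for `f ∈ C^a` with constant `C_f`
and `g` with oscillation `≤ w` at scale `ε`,
`|∫ k_ε(y) (f(x-y) - f(x)) (g(x-y) - g(x)) dy| ≤ (C_f ε^a) w`. [cite: ConstantinETiti1994, (9)] -/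
theorem abs_commutatorRemainder_le_of_osc {f g : UnitAddTorus d → ℝ} {Cf a : ℝ≥0} {w : ℝ}
    (hf : HolderWith Cf a f) (hg : ∀ x y : UnitAddTorus d, ‖y‖ ≤ ε → |g (x - y) - g x| ≤ w)
    (hε : 0 < ε) (hε' : ε ≤ 1 / 4) (x : UnitAddTorus d) :
    |∫ y, Torus.kernel ε y * ((f (x - y) - f x) * (g (x - y) - g x))| ≤
      Cf * ε ^ (a : ℝ) * w := by
  refine Torus.abs_integral_kernel_mul_le hε hε' fun y hy => ?_
  rw [abs_mul]
  exact mul_le_mul (Torus.abs_sub_le_of_holderWith_of_norm_le hf x hy.le) (hg x y hy.le)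
    (abs_nonneg _) (by positivity)

/-- **The Constantin–E–Titi commutator estimate, scale-local in the scalar** (sup form of CET
(10)–(11); DEIJ 2022, proof of Thm. 4, `|τ_ℓ(f,g)|_{L^∞}`): for integrable `f ∈ C^a` and `g` with
oscillation `≤ w` at scale `ε`, `fg` integrable,
`|((fg) ⋆ k_ε)(x) - (f ⋆ k_ε)(x) (g ⋆ k_ε)(x)| ≤ 2 (C_f ε^a) w`.
[cite: DrivasEtAl2022, proof of Thm. 4] -/
theorem abs_commutator_le_of_osc {f g : UnitAddTorus d → ℝ} (hfi : Integrable f volume)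
    (hgi : Integrable g volume) (hfg : Integrable (fun x => f x * g x) volume) {Cf a : ℝ≥0}
    {w : ℝ} (hf : HolderWith Cf a f)
    (hg : ∀ x y : UnitAddTorus d, ‖y‖ ≤ ε → |g (x - y) - g x| ≤ w) (hε : 0 < ε)
    (hε' : ε ≤ 1 / 4) (x : UnitAddTorus d) :
    |((fun y => f y * g y) ⋆ Torus.kernel ε) x - (f ⋆ Torus.kernel ε) x * (g ⋆ Torus.kernel ε) x| ≤
      2 * (Cf * ε ^ (a : ℝ) * w) := by
  rw [Torus.convolution_mul_sub_mul_convolution hfi hgi hfg hε hε' x]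
  have h1 := abs_commutatorRemainder_le_of_osc hf hg hε hε' x
  have h2 : |(f x - (f ⋆ Torus.kernel ε) x) * (g x - (g ⋆ Torus.kernel ε) x)| ≤
      Cf * ε ^ (a : ℝ) * w := by
    rw [abs_mul, abs_sub_comm (f x), abs_sub_comm (g x)]
    exact mul_le_mul (Torus.abs_convolution_kernel_sub_self_le hfi hf hε hε' x)
      (abs_convolution_kernel_sub_self_le_of_osc hgi hg hε hε' x) (abs_nonneg _) (by positivity)
  calc _ ≤ |∫ y, Torus.kernel ε y * ((f (x - y) - f x) * (g (x - y) - g x))| +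
        |(f x - (f ⋆ Torus.kernel ε) x) * (g x - (g ⋆ Torus.kernel ε) x)| := abs_sub _ _
    _ ≤ _ := by linarith

/-- **The integrated scalar cumulant against the oscillation at one scale** (DEIJ 2022, proof
of Thm. 4, the term `½∫τ_ℓ(θ,θ)`, `τ_ℓ(f,f) ≥ 0`): for continuous `f` with oscillation `≤ w` at
scale `ε`, `∫ f² - ∫ (f ⋆ k_ε)² ≤ w²` (the case `w = C_f ε^b` is
`Torus.integral_sq_sub_integral_convolution_sq_le`). [cite: DrivasEtAl2022, proof of Thm. 4] -/
theorem integral_sq_sub_integral_convolution_sq_le_of_osc {f : UnitAddTorus d → ℝ}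
    (hfc : Continuous f) {w : ℝ}
    (hf : ∀ x y : UnitAddTorus d, ‖y‖ ≤ ε → |f (x - y) - f x| ≤ w) (hε : 0 < ε) (hε' : ε ≤ 1 / 4) :
    (∫ x, f x ^ 2) - ∫ x, (f ⋆ Torus.kernel ε) x ^ 2 ≤ w ^ 2 := by
  have hk := Torus.isSmooth_kernel (d := d) hε hε'
  have hfi : Integrable f volume := hfc.integrable_unitAddTorus
  have hff : Integrable (fun x => f x * f x) volume := (hfc.mul hfc).integrable_unitAddTorus
  -- `∫ f² = ∫ (f²) ⋆ k`
  have hmass : ∫ x, f x ^ 2 = ∫ x, ((fun y => f y * f y) ⋆ Torus.kernel ε) x := by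
    rw [integral_convolution (ContinuousLinearMap.lsmul ℝ ℝ) hff hk.continuous.integrable_unitAddTorus,
      ContinuousLinearMap.lsmul_apply, Torus.integral_kernel hε hε', smul_eq_mul, mul_one]
    exact integral_congr_ae (Eventually.of_forall fun x => sq (f x))
  have hA : Continuous (f ⋆ Torus.kernel ε) := Torus.continuous_convolution hfi hk.continuous
  have hB : Continuous ((fun y => f y * f y) ⋆ Torus.kernel ε) :=
    Torus.continuous_convolution hff hk.continuous
  have hA2 : Integrable (fun x => (f ⋆ Torus.kernel ε) x ^ 2) volume :=
    (hA.pow 2 : Continuous fun x => (f ⋆ Torus.kernel ε) x ^ 2).integrable_unitAddTorus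
  rw [hmass, ← integral_sub hB.integrable_unitAddTorus hA2]
  have hr : ∀ x, |∫ y, Torus.kernel ε y * ((f (x - y) - f x) * (f (x - y) - f x))| ≤ w * w := by
    intro x
    refine Torus.abs_integral_kernel_mul_le hε hε' fun y hy => ?_
    rw [abs_mul]
    exact mul_le_mul (hf x y hy.le) (hf x y hy.le) (abs_nonneg _)
      ((abs_nonneg _).trans (hf x y hy.le))
  have hpt : ∀ x, ((fun y => f y * f y) ⋆ Torus.kernel ε) x - (f ⋆ Torus.kernel ε) x ^ 2 ≤ w ^ 2 := by
    intro x
    have hcet := Torus.convolution_mul_sub_mul_convolution hfi hfi hff hε hε' x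
    rw [sq, hcet, sq]
    have hr' := (le_abs_self _).trans (hr x)
    nlinarith [mul_self_nonneg (f x - (f ⋆ Torus.kernel ε) x)]
  calc ∫ x, (((fun y => f y * f y) ⋆ Torus.kernel ε) x - (f ⋆ Torus.kernel ε) x ^ 2)
      ≤ ∫ _x : UnitAddTorus d, w ^ 2 :=
        integral_mono (hB.integrable_unitAddTorus.sub hA2) (integrable_const _) hpt
    _ = w ^ 2 := by simp

end FunctionSpaces

/-! ## The slice bound against the oscillation at one scale -/

section Slice

variable {d : Type*} [Fintype d] [DecidableEq d]
variable {δ : UnitAddTorus d → ℝ} {v : UnitAddTorus d → EuclideanSpace ℝ d} {ε Cv : ℝ}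

/-- **The slice bound, scale-local in the scalar** (DEIJ 2022, proof of Thm. 4, (5.10) per unit
time, read against the oscillation): for continuous `δ` with `|δ(x-y) - δ(x)| ≤ w` whenever
`‖y‖ ≤ ε`, a bounded measurable weakly divergence-free `v ∈ C^α` (Hölder constant `C_u`),
`0 < ε ≤ 1/4`, `κ ≥ 0`, `k = kernel ε`, `A = δ ⋆ k` and the flux
`G(x) = ∫ δ(y) (-⟪v y, ∇k(x-y)⟫ + κ Δk(x-y)) dy`,
`-∫ A G = κ ∫ ‖∇A‖² - ∫ δ ⟪v, ∇B⟫ ≤ d · P · Q + κ · d · P²` with `P = (C₁/ε) w ≥ sup |∂ⱼA|` and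
`Q = 2 C_u ε^α w ≥ sup |τⱼ|`: the shape of `Torus.neg_integral_conv_mul_flux_le_of_holderWith`
with `C_θ ε^β` replaced by `w`. [cite: DrivasEtAl2022, proof of Thm. 4, (5.10)] -/
theorem neg_integral_conv_mul_flux_le_of_osc (hδ : Continuous δ) {w : ℝ}
    (hδw : ∀ x y : UnitAddTorus d, ‖y‖ ≤ ε → |δ (x - y) - δ x| ≤ w)
    (hv : AEStronglyMeasurable v volume) (hCv : ∀ y, ‖v y‖ ≤ Cv)
    {Cu α : ℝ≥0} (hvH : HolderWith Cu α v) (hdiv : Torus.IsWeaklyDivFree v)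
    (hε : 0 < ε) (hε' : ε ≤ 1 / 4) {κ : ℝ} (hκ : 0 ≤ κ) :
    -(∫ x, (δ ⋆ Torus.kernel ε) x * ∫ y, δ y *
        (-⟪v y, Torus.gradient (Torus.kernel ε) (x - y)⟫_ℝ +
          κ * Torus.laplacian (Torus.kernel ε) (x - y))) ≤
      Fintype.card d * (ε⁻¹ * Torus.gradProfileMass d * w) * (2 * (Cu * ε ^ (α : ℝ) * w)) +
        κ * (Fintype.card d * (ε⁻¹ * Torus.gradProfileMass d * w) ^ 2) := by
  set k : UnitAddTorus d → ℝ := Torus.kernel ε with hk_def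
  have hk : Torus.IsSmooth k := Torus.isSmooth_kernel hε hε'
  have hδi : Integrable δ volume := hδ.integrable_unitAddTorus
  have hA : Torus.IsSmooth (δ ⋆ k) := Torus.isSmooth_convolution hδi hk
  have hA1 : Torus.IsContDiff 1 (δ ⋆ k) := hA.isContDiff (by simp)
  have hvI := fun j => Torus.integrable_apply_mul_of_norm_le hδ hv hCv j
  have hw0 : 0 ≤ w := osc_nonneg hε.le hδw
  rw [Torus.integral_conv_mul_flux_eq hδi hv (Eventually.of_forall hCv) hε hε' κ, neg_sub]
  set P : ℝ := ε⁻¹ * Torus.gradProfileMass d * w with hP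
  set Q : ℝ := 2 * (Cu * ε ^ (α : ℝ) * w) with hQ
  have hP0 : 0 ≤ P :=
    mul_nonneg (mul_nonneg (inv_nonneg.2 hε.le) Torus.gradProfileMass_nonneg) hw0
  have hPj : ∀ j x, |Torus.partialDeriv j (δ ⋆ k) x| ≤ P := fun j x =>
    abs_partialDeriv_convolution_kernel_le_of_osc hδi hδw hε hε' j x
  have hτ : ∀ j x, |((fun y => v y j * δ y) ⋆ k) x - ((fun y => v y j) ⋆ k) x * (δ ⋆ k) x| ≤ Q :=
    fun j x => abs_commutator_le_of_osc (hvI j).2.1 hδi (hvI j).2.2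
      (Torus.holderWith_apply hvH j) hδw hε hε' x
  -- (a) the transport pairing
  have ha : |∫ y, δ y * ⟪v y, Torus.gradient ((δ ⋆ k) ⋆ k) y⟫_ℝ| ≤ Fintype.card d * P * Q := by
    rw [Torus.integral_mul_inner_gradient_conv_conv_eq_sum hδ hv hCv hdiv hε hε']
    refine (Finset.abs_sum_le_sum_abs _ _).trans ?_
    have hj : ∀ j, |∫ x, Torus.partialDeriv j (δ ⋆ k) x *
        (((fun y => v y j * δ y) ⋆ k) x - ((fun y => v y j) ⋆ k) x * (δ ⋆ k) x)| ≤ P * Q := by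
      intro j
      have h := norm_integral_le_of_norm_le (μ := (volume : Measure (UnitAddTorus d)))
        (f := fun x => Torus.partialDeriv j (δ ⋆ k) x *
          (((fun y => v y j * δ y) ⋆ k) x - ((fun y => v y j) ⋆ k) x * (δ ⋆ k) x))
        (integrable_const (P * Q)) (Eventually.of_forall fun x => by
          rw [norm_mul, Real.norm_eq_abs, Real.norm_eq_abs]
          exact mul_le_mul (hPj j x) (hτ j x) (abs_nonneg _) hP0)
      simpa using h
    calc ∑ j, |∫ x, Torus.partialDeriv j (δ ⋆ k) x *
          (((fun y => v y j * δ y) ⋆ k) x - ((fun y => v y j) ⋆ k) x * (δ ⋆ k) x)|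
        ≤ ∑ _j : d, P * Q := Finset.sum_le_sum fun j _ => hj j
      _ = Fintype.card d * P * Q := by
          rw [Finset.sum_const, Finset.card_univ, nsmul_eq_mul]
          ring
  -- (b) the resolved dissipation
  have hb : ∫ x, ‖Torus.gradient (δ ⋆ k) x‖ ^ 2 ≤ Fintype.card d * P ^ 2 := by
    have hpt : ∀ x, ‖Torus.gradient (δ ⋆ k) x‖ ^ 2 ≤ Fintype.card d * P ^ 2 := by
      intro x
      rw [EuclideanSpace.norm_sq_eq]
      calc ∑ j, ‖Torus.gradient (δ ⋆ k) x j‖ ^ 2 ≤ ∑ _j : d, P ^ 2 := by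
            refine Finset.sum_le_sum fun j _ => ?_
            rw [Torus.gradient_apply hA1, Real.norm_eq_abs]
            exact pow_le_pow_left₀ (abs_nonneg _) (hPj j x) 2
        _ = Fintype.card d * P ^ 2 := by
            rw [Finset.sum_const, Finset.card_univ, nsmul_eq_mul]
    calc ∫ x, ‖Torus.gradient (δ ⋆ k) x‖ ^ 2 ≤ ∫ _x : UnitAddTorus d, (Fintype.card d * P ^ 2 : ℝ) :=
          integral_mono ((hA.gradient.continuous.norm.pow 2 :
            Continuous fun x => ‖Torus.gradient (δ ⋆ k) x‖ ^ 2).integrable_unitAddTorus)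
            (integrable_const _) hpt
      _ = Fintype.card d * P ^ 2 := by simp
  have ha' := (neg_le_abs _).trans ha
  have hb' := mul_le_mul_of_nonneg_left hb hκ
  linarith

end Slice

end ScaleLocalCorner

/-! ## The dissipation bound against the oscillation at one scale -/

/-- **The bound (5.10) at `t = 0`, scale-local form** (barrier audit 2026-08-17, gen 17; scope
caveat (xiii) of `DrivasElgindiIyerJeong2022_thm4`): let `u ∈ L¹(0,T; C^{0,α})` with
`‖u‖_{L¹C^{0,α}} ≤ K`, `0 < ε ≤ 1/4` ONE mollification scale, `θ₀` continuous with oscillation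
`|θ₀(x-y) - θ₀(x)| ≤ w₀` for `‖y‖ ≤ ε`, `κ > 0`, and `θ` a weak solution of
`∂ₜθ + u·∇θ = κΔθ`, `θ(0) = θ₀` on `T^d × [0,T)` obeying the energy balance, with `θ(t)`
continuous and `|θ(t, x-y) - θ(t, x)| ≤ w` for `‖y‖ ≤ ε`, for a.e. `t ∈ (0,T)` — NO hypothesis on
the scalar at scales `‖y‖ > ε`, and none on the size of `w`. Then
`2κ ∫₀ᵀ ‖∇θ‖²_{L²} ≤ w₀² + 2 (2 d C₁ w² ε^{α-1} K + T κ d (C₁ w/ε)²)`, `C₁ = Torus.gradProfileMass d`,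
`d = card d`: the three terms of (5.10) with `[θ]_β ε^β ↦ w`, `[θ₀]_β ε^β ↦ w₀`; the bound
`DrivasElgindiIyerJeong2022_thm4.two_mul_eScalarDissipation_le` of the discharge is the case
`w = w₀ = M ε^β`. [cite: DrivasEtAl2022, proof of Thm. 4, (5.8)–(5.10)] -/
theorem two_mul_eScalarDissipation_le_scaleLocal {d : Type*} [Fintype d]
    [DecidableEq d] {T : ℝ} (hT : 0 < T) {α : ℝ≥0} {K : ℝ≥0}
    {u : ℝ → UnitAddTorus d → EuclideanSpace ℝ d} (hu : MemLpHolder 1 α u (Ioo 0 T))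
    (huK : eLpHolderNorm 1 α u (Ioo 0 T) ≤ K) {ε : ℝ} (hε : 0 < ε) (hε' : ε ≤ 1 / 4)
    {θ₀ : UnitAddTorus d → ℝ} (hθ₀c : Continuous θ₀) {w₀ : ℝ}
    (hθ₀w : ∀ x y : UnitAddTorus d, ‖y‖ ≤ ε → |θ₀ (x - y) - θ₀ x| ≤ w₀)
    {κ : ℝ} (hκ : 0 < κ) {θ : ℝ → UnitAddTorus d → ℝ}
    (hθ : Torus.IsWeakScalarTransportOn T κ u θ₀ θ)
    (henergy : ∀ᵐ t ∂((volume : Measure ℝ).restrict (Ioo 0 T)),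
      (∫⁻ x, ‖θ t x‖ₑ ^ 2) + 2 * Torus.eScalarDissipation κ θ 0 t ≤ ∫⁻ x, ‖θ₀ x‖ₑ ^ 2)
    (hcont : ∀ᵐ t ∂((volume : Measure ℝ).restrict (Ioo 0 T)), Continuous (θ t)) {w : ℝ}
    (hw : ∀ᵐ t ∂((volume : Measure ℝ).restrict (Ioo 0 T)),
      ∀ x y : UnitAddTorus d, ‖y‖ ≤ ε → |θ t (x - y) - θ t x| ≤ w) :
    2 * Torus.eScalarDissipation κ θ 0 T ≤ ENNReal.ofReal
      (w₀ ^ 2 + 2 * ((2 * Fintype.card d * Torus.gradProfileMass d * w ^ 2 * (ε⁻¹ * ε ^ (α : ℝ))) * K +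
          T * (κ * (Fintype.card d * (ε⁻¹ * Torus.gradProfileMass d * w) ^ 2)))) := by
  have hθ₀i : Integrable θ₀ volume := hθ₀c.integrable_unitAddTorus
  set k : UnitAddTorus d → ℝ := Torus.kernel ε with hk_def
  have hk : Torus.IsSmooth k := Torus.isSmooth_kernel hε hε'
  -- constants
  set C₁ : ℝ := Torus.gradProfileMass d with hC₁
  have hC₁0 : 0 ≤ C₁ := Torus.gradProfileMass_nonneg
  set c₁ : ℝ := 2 * Fintype.card d * C₁ * w ^ 2 * (ε⁻¹ * ε ^ (α : ℝ)) with hc₁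
  set c₂ : ℝ := κ * (Fintype.card d * (ε⁻¹ * C₁ * w) ^ 2) with hc₂
  have hc₁0 : 0 ≤ c₁ := by positivity
  have hc₂0 : 0 ≤ c₂ := by positivity
  -- Step 1: the slice bound, for a.e. `s`
  have hslice : ∀ᵐ s ∂((volume : Measure ℝ).restrict (Ioo 0 T)),
      -(∫ x, ((θ s) ⋆ k) x * ∫ y, θ s y *
        (-⟪u s y, Torus.gradient k (x - y)⟫_ℝ + κ * Torus.laplacian k (x - y))) ≤
        c₁ * boundedHolderNorm α (u s) + c₂ := by
    filter_upwards [hcont, hw, hu.1, hθ.ae_isWeaklyDivFree, hθ.ae_aestronglyMeasurable_velocity_slice]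
      with s hsc hsw hsu hdiv hum
    have huH : HolderWith (nnHolderNorm α (u s)) α (u s) := hsu.memHolder.holderWith
    have hCv : ∀ y, ‖u s y‖ ≤ (eSupNorm (u s)).toReal := fun y => by
      rw [← toReal_enorm]
      exact ENNReal.toReal_mono hsu.eSupNorm_lt_top.ne (enorm_le_eSupNorm (u s) y)
    have hle : ((nnHolderNorm α (u s) : ℝ≥0) : ℝ) ≤ boundedHolderNorm α (u s) :=
      ENNReal.toReal_mono hsu.ne (eHolderNorm_le_eBoundedHolderNorm α (u s))
    have h := ScaleLocalCorner.neg_integral_conv_mul_flux_le_of_osc hsc hsw hum hCv huH hdiv hε hε'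
      hκ.le
    have hn0 : 0 ≤ ((nnHolderNorm α (u s) : ℝ≥0) : ℝ) := NNReal.coe_nonneg _
    have hw2 : 0 ≤ 2 * Fintype.card d * C₁ * w ^ 2 * (ε⁻¹ * ε ^ (α : ℝ)) := by positivity
    calc _ ≤ _ := h
      _ = (2 * Fintype.card d * C₁ * w ^ 2 * (ε⁻¹ * ε ^ (α : ℝ))) *
            ((nnHolderNorm α (u s) : ℝ≥0) : ℝ) + c₂ := by
          rw [hc₂]
          ring
      _ ≤ (2 * Fintype.card d * C₁ * w ^ 2 * (ε⁻¹ * ε ^ (α : ℝ))) * boundedHolderNorm α (u s) + c₂ := by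
          gcongr
      _ = c₁ * boundedHolderNorm α (u s) + c₂ := by rw [hc₁]
  -- Step 2: the time integral of the slice bound, in `ℝ≥0∞`
  have hKint : ∫⁻ s in Ioo 0 T, ENNReal.ofReal (boundedHolderNorm α (u s)) ≤ K := by
    have e : ∫⁻ s in Ioo 0 T, ENNReal.ofReal (boundedHolderNorm α (u s)) =
        eLpHolderNorm 1 α u (Ioo 0 T) := by
      rw [eLpHolderNorm, eLpNorm_one_eq_lintegral_enorm]
      refine lintegral_congr fun s => ?_
      exact (Real.enorm_eq_ofReal ENNReal.toReal_nonneg).symm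
    rw [e]
    exact huK
  have htime : ∀ t ∈ Ioo 0 T,
      ENNReal.ofReal (∫ s in Ioc 0 t, -(∫ x, ((θ s) ⋆ k) x * ∫ y, θ s y *
        (-⟪u s y, Torus.gradient k (x - y)⟫_ℝ + κ * Torus.laplacian k (x - y)))) ≤
        ENNReal.ofReal c₁ * K + ENNReal.ofReal c₂ * ENNReal.ofReal T := by
    intro t ht
    refine (ofReal_integral_le_lintegral_ofReal _).trans ?_
    refine (lintegral_mono_set (Ioc_subset_Ioo_right ht.2)).trans ?_
    have hmono : ∫⁻ s in Ioo 0 T, ENNReal.ofReal (-(∫ x, ((θ s) ⋆ k) x * ∫ y, θ s y *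
        (-⟪u s y, Torus.gradient k (x - y)⟫_ℝ + κ * Torus.laplacian k (x - y)))) ≤
        ∫⁻ s in Ioo 0 T, (ENNReal.ofReal c₁ * ENNReal.ofReal (boundedHolderNorm α (u s)) +
          ENNReal.ofReal c₂) := by
      refine lintegral_mono_ae (hslice.mono fun s hs => ?_)
      have hb0 : 0 ≤ boundedHolderNorm α (u s) := ENNReal.toReal_nonneg
      rw [← ENNReal.ofReal_mul hc₁0, ← ENNReal.ofReal_add (mul_nonneg hc₁0 hb0) hc₂0]
      exact ENNReal.ofReal_le_ofReal hs
    refine hmono.trans ?_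
    rw [lintegral_add_right _ measurable_const, lintegral_const_mul' _ _ ENNReal.ofReal_ne_top,
      lintegral_const, Measure.restrict_apply_univ, Real.volume_Ioo, sub_zero]
    gcongr
  -- Step 3: the bound for a.e. `t`
  have hmain : ∀ᵐ t ∂((volume : Measure ℝ).restrict (Ioo 0 T)), 2 * Torus.eScalarDissipation κ θ 0 t ≤
      ENNReal.ofReal (w₀ ^ 2) + 2 * (ENNReal.ofReal c₁ * K + ENNReal.ofReal c₂ * ENNReal.ofReal T) := by
    filter_upwards [henergy, hθ.ae_integral_sq_molInt_eq hθ₀i hk, ae_restrict_mem measurableSet_Ioo,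
      hθ.ae_slice_integrable₁] with t hen hid htT hint
    have hθti : Integrable (θ t) volume := hint.1
    have hAc : Continuous ((θ t) ⋆ k) := Torus.continuous_convolution hθti hk.continuous
    -- Young: `‖θ(t) ⋆ k‖₂ ≤ ‖θ(t)‖₂`
    have hY : ∫⁻ x, ‖((θ t) ⋆ k) x‖ₑ ^ 2 ≤ ∫⁻ x, ‖θ t x‖ₑ ^ 2 := by
      rw [← PassiveScalarProofs.eLpNorm_two_pow_two, ← PassiveScalarProofs.eLpNorm_two_pow_two]
      gcongr
      calc eLpNorm ((θ t) ⋆ k) 2 volume ≤ (∫⁻ y, ‖k y‖ₑ) * eLpNorm (θ t) 2 volume :=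
            Torus.eLpNorm_convolution_le hθti.aestronglyMeasurable hk.continuous.aestronglyMeasurable
              one_le_two
        _ = eLpNorm (θ t) 2 volume := by rw [hk_def, Torus.lintegral_enorm_kernel hε hε', one_mul]
    have e0 : ∫⁻ x, ‖θ₀ x‖ₑ ^ 2 = ENNReal.ofReal (∫ x, θ₀ x ^ 2) :=
      Torus.lintegral_enorm_sq_eq_ofReal_integral_sq hθ₀c
    have eA : ∫⁻ x, ‖((θ t) ⋆ k) x‖ₑ ^ 2 = ENNReal.ofReal (∫ x, ((θ t) ⋆ k) x ^ 2) :=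
      Torus.lintegral_enorm_sq_eq_ofReal_integral_sq hAc
    have h1 : ENNReal.ofReal (∫ x, ((θ t) ⋆ k) x ^ 2) + 2 * Torus.eScalarDissipation κ θ 0 t ≤
        ENNReal.ofReal (∫ x, θ₀ x ^ 2) := by
      rw [← eA, ← e0]
      exact (add_le_add hY le_rfl).trans hen
    have h2 : 2 * Torus.eScalarDissipation κ θ 0 t ≤
        ENNReal.ofReal ((∫ x, θ₀ x ^ 2) - ∫ x, ((θ t) ⋆ k) x ^ 2) := by
      rw [ENNReal.ofReal_sub _ (integral_nonneg fun x => sq_nonneg _)]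
      exact ENNReal.le_sub_of_add_le_left ENNReal.ofReal_ne_top h1
    have h3 : (∫ x, θ₀ x ^ 2) - ∫ x, ((θ t) ⋆ k) x ^ 2 ≤ w₀ ^ 2 +
        2 * ∫ s in Ioc 0 t, -(∫ x, ((θ s) ⋆ k) x * ∫ y, θ s y *
          (-⟪u s y, Torus.gradient k (x - y)⟫_ℝ + κ * Torus.laplacian k (x - y))) := by
      rw [hid, integral_neg]
      have := ScaleLocalCorner.integral_sq_sub_integral_convolution_sq_le_of_osc hθ₀c hθ₀w hε hε'
      linarith
    calc 2 * Torus.eScalarDissipation κ θ 0 t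
        ≤ ENNReal.ofReal ((∫ x, θ₀ x ^ 2) - ∫ x, ((θ t) ⋆ k) x ^ 2) := h2
      _ ≤ ENNReal.ofReal (w₀ ^ 2 +
          2 * ∫ s in Ioc 0 t, -(∫ x, ((θ s) ⋆ k) x * ∫ y, θ s y *
            (-⟪u s y, Torus.gradient k (x - y)⟫_ℝ + κ * Torus.laplacian k (x - y)))) :=
          ENNReal.ofReal_le_ofReal h3
      _ ≤ ENNReal.ofReal (w₀ ^ 2) +
          ENNReal.ofReal (2 * ∫ s in Ioc 0 t, -(∫ x, ((θ s) ⋆ k) x * ∫ y, θ s y *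
            (-⟪u s y, Torus.gradient k (x - y)⟫_ℝ + κ * Torus.laplacian k (x - y)))) :=
          ENNReal.ofReal_add_le
      _ ≤ _ := by
          rw [ENNReal.ofReal_mul zero_le_two, ENNReal.ofReal_ofNat]
          gcongr
          exact htime t htT
  -- Step 4: from a.e. `t` to `T`
  have h2D : ∀ t, 2 * Torus.eScalarDissipation κ θ 0 t =
      ∫⁻ s in Ioo 0 t, 2 * (ENNReal.ofReal κ * Torus.eScalarGradNormSq (θ s)) := fun t => by
    rw [Torus.eScalarDissipation, ← lintegral_const_mul' _ _ ENNReal.ofReal_ne_top,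
      ← lintegral_const_mul' _ _ ENNReal.ofNat_ne_top]
  have hfin : 2 * Torus.eScalarDissipation κ θ 0 T ≤
      ENNReal.ofReal (w₀ ^ 2) + 2 * (ENNReal.ofReal c₁ * K + ENNReal.ofReal c₂ * ENNReal.ofReal T) := by
    rw [h2D]
    refine setLIntegral_Ioo_le_of_ae_le hT ?_
    filter_upwards [hmain] with t ht
    rwa [h2D] at ht
  refine hfin.trans (le_of_eq ?_)
  have e2 : ENNReal.ofReal c₁ * (K : ℝ≥0∞) + ENNReal.ofReal c₂ * ENNReal.ofReal T =
      ENNReal.ofReal (c₁ * K + T * c₂) := by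
    rw [ENNReal.ofReal_add (by positivity) (by positivity), ENNReal.ofReal_mul hc₁0,
      ENNReal.ofReal_coe_nnreal, ENNReal.ofReal_mul (le_of_lt hT),
      mul_comm (ENNReal.ofReal T) (ENNReal.ofReal c₂)]
  have e3 : (2 : ℝ≥0∞) * ENNReal.ofReal (c₁ * K + T * c₂) =
      ENNReal.ofReal (2 * (c₁ * K + T * c₂)) := by
    rw [ENNReal.ofReal_mul zero_le_two, ENNReal.ofReal_ofNat]
  rw [e2, e3]
  exact (ENNReal.ofReal_add (by positivity) (by positivity)).symm

/-! ## Consequences: one good scale, and the witness constraint at every scale -/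

/-- **One good scale kills the anomaly** (barrier audit 2026-08-17, gen 17; scope caveat (xiii)
of `DrivasElgindiIyerJeong2022_thm4`, family form of `two_mul_eScalarDissipation_le_scaleLocal`).
Let `T > 0`, `α ≥ 0`, and for each `j`: a divergence-free field `u_j ∈ L¹(0,T; C^{0,α})` with
`‖u_j‖_{L¹C^{0,α}} ≤ K`, a diffusivity `κ_j > 0` (no convergence to `0` asked), ONE scale
`ℓ_j ∈ (0, 1/4]`, a continuous datum `θ₀,ⱼ` with oscillation `≤ w₀,ⱼ` at scale `ℓ_j`, and a weak
solution `θ_j` obeying the energy balance whose a.e. slice is continuous with oscillation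
`≤ w_j` at scale `ℓ_j`. If `w₀,ⱼ² → 0`, `w_j² ℓ_j^{α-1} → 0` and `κ_j (w_j/ℓ_j)² → 0`, then
`κ_j ∫₀ᵀ ‖∇θ_j‖²_{L²} → 0` — whatever the scalars do at scales above `ℓ_j`, and whatever the
size of their Hölder (semi)norms. [cite: DrivasEtAl2022, Thm. 4 and its proof, (5.10)] -/
theorem DrivasElgindiIyerJeong2022_thm4_scaleLocal.noAnomaly_of_one_good_scale
    (d : Type) [Fintype d] [DecidableEq d] (T : ℝ) (hT : 0 < T) (α : ℝ≥0) (K : ℝ≥0)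
    (u : ℕ → ℝ → UnitAddTorus d → EuclideanSpace ℝ d)
    (hu : ∀ j, MemLpHolder 1 α (u j) (Ioo 0 T))
    (huK : ∀ j, eLpHolderNorm 1 α (u j) (Ioo 0 T) ≤ K)
    (κ : ℕ → ℝ) (hκ : ∀ j, 0 < κ j)
    (ℓ : ℕ → ℝ) (hℓ : ∀ j, 0 < ℓ j) (hℓ' : ∀ j, ℓ j ≤ 1 / 4)
    (θ₀ : ℕ → UnitAddTorus d → ℝ) (hθ₀c : ∀ j, Continuous (θ₀ j)) (w₀ : ℕ → ℝ)
    (hθ₀w : ∀ j, ∀ x y : UnitAddTorus d, ‖y‖ ≤ ℓ j → |θ₀ j (x - y) - θ₀ j x| ≤ w₀ j)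
    (θ : ℕ → ℝ → UnitAddTorus d → ℝ)
    (hθ : ∀ j, Torus.IsWeakScalarTransportOn T (κ j) (u j) (θ₀ j) (θ j))
    (henergy : ∀ j, ∀ᵐ t ∂(volume.restrict (Ioo 0 T)),
      (∫⁻ x, ‖θ j t x‖ₑ ^ 2) + 2 * Torus.eScalarDissipation (κ j) (θ j) 0 t ≤
        ∫⁻ x, ‖θ₀ j x‖ₑ ^ 2)
    (hcont : ∀ j, ∀ᵐ t ∂(volume.restrict (Ioo 0 T)), Continuous (θ j t)) (w : ℕ → ℝ)
    (hw : ∀ j, ∀ᵐ t ∂(volume.restrict (Ioo 0 T)),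
      ∀ x y : UnitAddTorus d, ‖y‖ ≤ ℓ j → |θ j t (x - y) - θ j t x| ≤ w j)
    (h₀ : Tendsto (fun j => w₀ j ^ 2) atTop (𝓝 0))
    (h₁ : Tendsto (fun j => w j ^ 2 * ((ℓ j)⁻¹ * ℓ j ^ (α : ℝ))) atTop (𝓝 0))
    (h₂ : Tendsto (fun j => κ j * ((ℓ j)⁻¹ * w j) ^ 2) atTop (𝓝 0)) :
    Tendsto (fun j => Torus.eScalarDissipation (κ j) (θ j) 0 T) atTop (𝓝 0) := by
  -- the explicit bound tends to `0`
  have hB : Tendsto (fun j => w₀ j ^ 2 +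
      2 * ((2 * Fintype.card d * Torus.gradProfileMass d * w j ^ 2 * ((ℓ j)⁻¹ * ℓ j ^ (α : ℝ))) * K +
        T * (κ j * (Fintype.card d * ((ℓ j)⁻¹ * Torus.gradProfileMass d * w j) ^ 2))))
      atTop (𝓝 0) := by
    have h := h₀.add (((h₁.const_mul (2 * Fintype.card d * Torus.gradProfileMass d * K)).add
      (h₂.const_mul (T * (Fintype.card d * Torus.gradProfileMass d ^ 2)))).const_mul 2)
    simp only [mul_zero, add_zero] at h
    refine Tendsto.congr (fun j => ?_) h
    ring
  have hup : Tendsto (fun j => ENNReal.ofReal (w₀ j ^ 2 +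
      2 * ((2 * Fintype.card d * Torus.gradProfileMass d * w j ^ 2 * ((ℓ j)⁻¹ * ℓ j ^ (α : ℝ))) * K +
        T * (κ j * (Fintype.card d * ((ℓ j)⁻¹ * Torus.gradProfileMass d * w j) ^ 2)))))
      atTop (𝓝 0) := by
    simpa using ENNReal.tendsto_ofReal hB
  refine tendsto_of_tendsto_of_tendsto_of_le_of_le' tendsto_const_nhds hup
    (Eventually.of_forall fun _ => bot_le) (Eventually.of_forall fun j => ?_)
  calc Torus.eScalarDissipation (κ j) (θ j) 0 T
      ≤ Torus.eScalarDissipation (κ j) (θ j) 0 T + Torus.eScalarDissipation (κ j) (θ j) 0 T :=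
        le_self_add
    _ = 2 * Torus.eScalarDissipation (κ j) (θ j) 0 T := (two_mul _).symm
    _ ≤ _ := two_mul_eScalarDissipation_le_scaleLocal hT (hu j) (huK j) (hℓ j) (hℓ' j) (hθ₀c j)
        (hθ₀w j) (hκ j) (hθ j) (henergy j) (hcont j) (hw j)

/-- **A Hölder bound at ONE scale above `κ^{1/(2-2β)}` excludes the anomaly** (barrier audit
2026-08-17, gen 17; scope caveat (xiii)): in the setting of `noAnomaly_of_one_good_scale` let
`β > 0`, `α + 2β > 1`, and suppose the datum and a.e. slice of `θ_j` are `β`-Hölder with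
constant `M` AT SCALES `‖y‖ ≤ ℓ_j` ONLY (`|θ_j(t,x-y) - θ_j(t,x)| ≤ M‖y‖^β` for `‖y‖ ≤ ℓ_j`; nothing
at larger scales), along scales `ℓ_j → 0` with `κ_j ℓ_j^{2β-2} → 0`. Then the dissipation tends
to `0`. Above the line `1/(2-2β) > 1/(1+α)`, so admissible scales exist strictly below the
print's `ℓ = κ^{1/(α+1)}` (e.g. `ℓ_j = κ_j^s`, any `s < 1/(2-2β)`): the block needs the scalar's
Hölder regularity on one band of small scales, not uniformly over all scales.
[cite: DrivasEtAl2022, Thm. 4 and its proof, (5.10)] -/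
theorem DrivasElgindiIyerJeong2022_thm4_scaleLocal.noAnomaly_of_holder_at_one_scale
    (d : Type) [Fintype d] [DecidableEq d] (T : ℝ) (hT : 0 < T) (α β : ℝ≥0)
    (hβ : 0 < β) (hOC : 1 < (α : ℝ) + 2 * β) (K M : ℝ≥0)
    (u : ℕ → ℝ → UnitAddTorus d → EuclideanSpace ℝ d)
    (hu : ∀ j, MemLpHolder 1 α (u j) (Ioo 0 T))
    (huK : ∀ j, eLpHolderNorm 1 α (u j) (Ioo 0 T) ≤ K)
    (κ : ℕ → ℝ) (hκ : ∀ j, 0 < κ j)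
    (ℓ : ℕ → ℝ) (hℓ : ∀ j, 0 < ℓ j) (hℓ' : ∀ j, ℓ j ≤ 1 / 4) (hℓ0 : Tendsto ℓ atTop (𝓝 0))
    (hκℓ : Tendsto (fun j => κ j * ℓ j ^ (2 * (β : ℝ) - 2)) atTop (𝓝 0))
    (θ₀ : ℕ → UnitAddTorus d → ℝ) (hθ₀c : ∀ j, Continuous (θ₀ j))
    (hθ₀H : ∀ j, ∀ x y : UnitAddTorus d, ‖y‖ ≤ ℓ j →
      |θ₀ j (x - y) - θ₀ j x| ≤ M * ‖y‖ ^ (β : ℝ))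
    (θ : ℕ → ℝ → UnitAddTorus d → ℝ)
    (hθ : ∀ j, Torus.IsWeakScalarTransportOn T (κ j) (u j) (θ₀ j) (θ j))
    (henergy : ∀ j, ∀ᵐ t ∂(volume.restrict (Ioo 0 T)),
      (∫⁻ x, ‖θ j t x‖ₑ ^ 2) + 2 * Torus.eScalarDissipation (κ j) (θ j) 0 t ≤
        ∫⁻ x, ‖θ₀ j x‖ₑ ^ 2)
    (hcont : ∀ j, ∀ᵐ t ∂(volume.restrict (Ioo 0 T)), Continuous (θ j t))
    (hH : ∀ j, ∀ᵐ t ∂(volume.restrict (Ioo 0 T)), ∀ x y : UnitAddTorus d, ‖y‖ ≤ ℓ j →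
      |θ j t (x - y) - θ j t x| ≤ M * ‖y‖ ^ (β : ℝ)) :
    Tendsto (fun j => Torus.eScalarDissipation (κ j) (θ j) 0 T) atTop (𝓝 0) := by
  have hβ' : (0 : ℝ) < β := by exact_mod_cast hβ
  -- the oscillation at scale `ℓ_j` is at most `M ℓ_j^β`
  have hincr : ∀ j (f : UnitAddTorus d → ℝ),
      (∀ x y : UnitAddTorus d, ‖y‖ ≤ ℓ j → |f (x - y) - f x| ≤ M * ‖y‖ ^ (β : ℝ)) →
      ∀ x y : UnitAddTorus d, ‖y‖ ≤ ℓ j → |f (x - y) - f x| ≤ (M : ℝ) * ℓ j ^ (β : ℝ) := by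
    intro j f hf x y hy
    exact (hf x y hy).trans
      (mul_le_mul_of_nonneg_left (Real.rpow_le_rpow (norm_nonneg _) hy hβ'.le) M.2)
  -- exponent bookkeeping
  have e₀ : ∀ j, ((M : ℝ) * ℓ j ^ (β : ℝ)) ^ 2 = (M : ℝ) ^ 2 * ℓ j ^ (2 * (β : ℝ)) := fun j => by
    rw [mul_pow, ← Real.rpow_natCast (ℓ j ^ (β : ℝ)) 2, ← Real.rpow_mul (hℓ j).le]
    congr 2
    push_cast
    ring
  have e₁ : ∀ j, ((M : ℝ) * ℓ j ^ (β : ℝ)) ^ 2 * ((ℓ j)⁻¹ * ℓ j ^ (α : ℝ)) =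
      (M : ℝ) ^ 2 * ℓ j ^ ((α : ℝ) + 2 * β - 1) := fun j => by
    have h1 : ℓ j ^ (2 * (β : ℝ)) * ((ℓ j)⁻¹ * ℓ j ^ (α : ℝ)) = ℓ j ^ ((α : ℝ) + 2 * β - 1) := by
      rw [← Real.rpow_neg_one (ℓ j), ← Real.rpow_add (hℓ j), ← Real.rpow_add (hℓ j)]
      congr 1
      ring
    rw [e₀ j, mul_assoc, h1]
  have e₂ : ∀ j, κ j * ((ℓ j)⁻¹ * ((M : ℝ) * ℓ j ^ (β : ℝ))) ^ 2 =
      (M : ℝ) ^ 2 * (κ j * ℓ j ^ (2 * (β : ℝ) - 2)) := fun j => by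
    have h2 : ((ℓ j)⁻¹) ^ 2 * ℓ j ^ (2 * (β : ℝ)) = ℓ j ^ (2 * (β : ℝ) - 2) := by
      rw [← Real.rpow_neg_one (ℓ j), ← Real.rpow_natCast ((ℓ j) ^ (-1 : ℝ)) 2,
        ← Real.rpow_mul (hℓ j).le, ← Real.rpow_add (hℓ j)]
      congr 1
      push_cast
      ring
    rw [mul_pow, e₀ j, ← h2]
    ring
  -- the three limits
  have hpow₀ : Tendsto (fun j => (M : ℝ) ^ 2 * ℓ j ^ (2 * (β : ℝ))) atTop (𝓝 0) := by
    simpa using (hℓ0.rpow_const_nhds_zero (p := 2 * (β : ℝ)) (by positivity)).const_mul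
      ((M : ℝ) ^ 2)
  have hpow₁ : Tendsto (fun j => (M : ℝ) ^ 2 * ℓ j ^ ((α : ℝ) + 2 * β - 1)) atTop (𝓝 0) := by
    simpa using (hℓ0.rpow_const_nhds_zero (p := (α : ℝ) + 2 * β - 1) (by linarith)).const_mul
      ((M : ℝ) ^ 2)
  have hpow₂ : Tendsto (fun j => (M : ℝ) ^ 2 * (κ j * ℓ j ^ (2 * (β : ℝ) - 2))) atTop (𝓝 0) := by
    simpa using hκℓ.const_mul ((M : ℝ) ^ 2)
  refine DrivasElgindiIyerJeong2022_thm4_scaleLocal.noAnomaly_of_one_good_scale d T hT α K u hu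
    huK κ hκ ℓ hℓ hℓ' θ₀ hθ₀c (fun j => (M : ℝ) * ℓ j ^ (β : ℝ))
    (fun j => hincr j (θ₀ j) (hθ₀H j)) θ hθ henergy hcont (fun j => (M : ℝ) * ℓ j ^ (β : ℝ))
    (fun j => (hH j).mono fun t ht => hincr j (θ j t) ht) ?_ ?_ ?_
  · simpa only [e₀] using hpow₀
  · simpa only [e₁] using hpow₁
  · simpa only [e₂] using hpow₂

/-- **The witness constraint at every inertial-range scale (inverse structure-function bound)**
(barrier audit 2026-08-17, gen 17; scope caveat (xiii) of `DrivasElgindiIyerJeong2022_thm4`,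
contrapositive reading of `two_mul_eScalarDissipation_le_scaleLocal`). In the setting of that
bound, at any scale `ε` at or above the Obukhov–Corrsin cut-off, `κ ≤ ε^{α+1}` (i.e.
`κ^{1/(α+1)} ≤ ε ≤ 1/4`), a dissipation floor `e ≤ 2κ∫₀ᵀ‖∇θ‖²_{L²}` forces
`e ≤ w₀² + 2 d C₁ (2K + C₁T) · w² ε^{α-1}`, i.e.
`w² ≥ (e - w₀²) ε^{1-α} / (2 d C₁ (2K + C₁ T))` for the sup-oscillation `w` of the scalar at
scale `ε` (a.e. in time): along a witness family with floor `e > 0`, velocity budget `K` and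
data whose unresolved oscillation `w₀,ⱼ(ε)²` stays below `e/2` (one fixed continuous datum, say),
the scalars satisfy `sup_{t,x,‖y‖≤ε} |θ_j(t,x-y) - θ_j(t,x)| ≥ c ε^{(1-α)/2}`,
`c² = e/(4dC₁(2K + C₁T))`, at EVERY `ε ∈ [κ_j^{1/(1+α)}, ε₀]` — the Obukhov–Corrsin scaling
`S^θ(ℓ) ∼ ℓ^{(1-α)/2}` over the inertial–convective range `ℓ_κ ≲ ℓ ≲ L^θ` of
[cite: DrivasEtAl2022, §5] as a floor for the sup-structure function, uniformly in `j`.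
[cite: DrivasEtAl2022, Thm. 4 and its proof, (5.10)] -/
theorem DrivasElgindiIyerJeong2022_thm4_scaleLocal.osc_sq_lower_bound {d : Type*} [Fintype d]
    [DecidableEq d] {T : ℝ} (hT : 0 < T) {α : ℝ≥0} {K : ℝ≥0}
    {u : ℝ → UnitAddTorus d → EuclideanSpace ℝ d} (hu : MemLpHolder 1 α u (Ioo 0 T))
    (huK : eLpHolderNorm 1 α u (Ioo 0 T) ≤ K) {ε : ℝ} (hε : 0 < ε) (hε' : ε ≤ 1 / 4)
    {θ₀ : UnitAddTorus d → ℝ} (hθ₀c : Continuous θ₀) {w₀ : ℝ}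
    (hθ₀w : ∀ x y : UnitAddTorus d, ‖y‖ ≤ ε → |θ₀ (x - y) - θ₀ x| ≤ w₀)
    {κ : ℝ} (hκ : 0 < κ) (hκε : κ ≤ ε ^ ((α : ℝ) + 1)) {θ : ℝ → UnitAddTorus d → ℝ}
    (hθ : Torus.IsWeakScalarTransportOn T κ u θ₀ θ)
    (henergy : ∀ᵐ t ∂((volume : Measure ℝ).restrict (Ioo 0 T)),
      (∫⁻ x, ‖θ t x‖ₑ ^ 2) + 2 * Torus.eScalarDissipation κ θ 0 t ≤ ∫⁻ x, ‖θ₀ x‖ₑ ^ 2)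
    (hcont : ∀ᵐ t ∂((volume : Measure ℝ).restrict (Ioo 0 T)), Continuous (θ t)) {w : ℝ}
    (hw : ∀ᵐ t ∂((volume : Measure ℝ).restrict (Ioo 0 T)),
      ∀ x y : UnitAddTorus d, ‖y‖ ≤ ε → |θ t (x - y) - θ t x| ≤ w) {e : ℝ}
    (he : ENNReal.ofReal e ≤ 2 * Torus.eScalarDissipation κ θ 0 T) :
    e ≤ w₀ ^ 2 + 2 * Fintype.card d * Torus.gradProfileMass d *
      (2 * K + Torus.gradProfileMass d * T) * (w ^ 2 * (ε⁻¹ * ε ^ (α : ℝ))) := by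
  have hC₁0 : 0 ≤ Torus.gradProfileMass d := Torus.gradProfileMass_nonneg
  have h := he.trans (two_mul_eScalarDissipation_le_scaleLocal hT hu huK hε hε' hθ₀c hθ₀w hκ hθ
    henergy hcont hw)
  have hB0 : 0 ≤ w₀ ^ 2 + 2 * ((2 * Fintype.card d * Torus.gradProfileMass d * w ^ 2 *
      (ε⁻¹ * ε ^ (α : ℝ))) * K +
      T * (κ * (Fintype.card d * (ε⁻¹ * Torus.gradProfileMass d * w) ^ 2))) := by positivity
  have h' := (ENNReal.ofReal_le_ofReal_iff hB0).1 h
  -- `κ ε⁻² ≤ ε^{α-1}` for `κ ≤ ε^{α+1}`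
  have hk : κ * ε⁻¹ ≤ ε ^ (α : ℝ) := by
    rw [mul_inv_le_iff₀ hε]
    calc κ ≤ ε ^ ((α : ℝ) + 1) := hκε
      _ = ε ^ (α : ℝ) * ε := by rw [Real.rpow_add hε, Real.rpow_one]
  have hk' : T * (κ * (Fintype.card d * (ε⁻¹ * Torus.gradProfileMass d * w) ^ 2)) ≤
      T * (Fintype.card d * Torus.gradProfileMass d ^ 2 * (w ^ 2 * (ε⁻¹ * ε ^ (α : ℝ)))) := by
    refine mul_le_mul_of_nonneg_left ?_ hT.le
    calc κ * (Fintype.card d * (ε⁻¹ * Torus.gradProfileMass d * w) ^ 2)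
        = Fintype.card d * Torus.gradProfileMass d ^ 2 * (w ^ 2 * (ε⁻¹ * (κ * ε⁻¹))) := by ring
      _ ≤ Fintype.card d * Torus.gradProfileMass d ^ 2 * (w ^ 2 * (ε⁻¹ * ε ^ (α : ℝ))) := by
          gcongr
  have hexp : w₀ ^ 2 + 2 * ((2 * Fintype.card d * Torus.gradProfileMass d * w ^ 2 *
      (ε⁻¹ * ε ^ (α : ℝ))) * K +
      T * (Fintype.card d * Torus.gradProfileMass d ^ 2 * (w ^ 2 * (ε⁻¹ * ε ^ (α : ℝ))))) =
      w₀ ^ 2 + 2 * Fintype.card d * Torus.gradProfileMass d *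
        (2 * K + Torus.gradProfileMass d * T) * (w ^ 2 * (ε⁻¹ * ε ^ (α : ℝ))) := by ring
  linarith [h', hk', hexp]

end Literature.Barriers.AnomalousDissipation

end
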